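import Summits.QuantumFields.BalabanUV.T4Continuum.Support.ShellMeasureBandCount
import Summits.QuantumFields.BalabanUV.T4Continuum.Support.ShellCountRoad

/-!
# `T4Continuum.ShellMeasureWindowLiaison` — NE7c crew row S9 (SM-L7 ∕ SM-L8 LIAISON, no new estimate): the window-and-
count binder and the rate binder of the root composition END-I `ShellMeasureRootComposition.shellWeightBound_of_slotAC`
PRODUCED BY NAME from road P2's cube count (torus geometry) and node U1b's geometric width, plus the one-slot closeness
push that the `SlotData.piece_le` instances consume (cell `pub-balaban`, rung (B)+1 cell `b2b-balaban-t4-*`; BINDER-OWNERS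
row NE7c; trigger `t4/T4-NE7c-TRIGGER.json` c4 ∕ c6; claim table `t4/b2b-balaban-t4-ne7c-p1/LEAVES-NE7c-P1.md` row S9,
claimant = road P2 co-owner `b2b-balaban-t4-ne7c-p2` gen 23 on the suppliers' lane)

HONEST FRAMING (T4-DAG PAGE 1).  Finite four-torus, rung (B)+1 only — NOT infinite volume, NOT a mass gap, NOT the Clay
problem.  NE7c (`T4IndicatorShell.ShellWeightBound`) is NOT PRINTED and NOT proved.  This module proves NO estimate: it
re-exports, in EXACTLY the binder shapes of END-I, (a) the live-window-and-count binder `T4ShellMeasureLevels.LiveWindow`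
from a per-age slot count of CUBE-COUNT shape (`ShellCountRoad.cubeCount_of_torus` ∘
`ShellMeasureBandCount.liveWindow_of_cubeCount`) and the same count in the `_band` twin's age-count shape; (b) the rate
binder `∀ j, ρ j ≤ c₁ϑ^j` for node U1b's width `ρ = T4SupCloseLiaison.geomWidth C θmin ϑ` (plus `0 ≤ ρ`, `Summable ρ`,
its total — the `_band` twin's inputs), NO rate proved (trigger c4: the rate is node U1b's `T4EtaRateMin.LocalRate`, NE3
species, NOT PRINTED for Bałaban's minimisers); (c) the ONE-SLOT CLOSENESS PUSH: a `LocalRate` reading of the slot's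
tested variable at consecutive levels and the threshold floor give `|u^A − u^B| ≤ ρ_j θ_j`, hence the design-(i)
mismatch factor `χ_θ(u^A)(1 − χ_θ(u^B))` (`T4IndicatorShell.smallInd`) is dominated POINTWISE by the indicator of EXACTLY
the event `{θ_j(1 − ρ_j) ≤ u^A < θ_j}` of `T4ShellMeasure.SlotAntiConcentration`, and its integral by the measure of that
event — the content of a `SlotData.piece_le` field for one mismatch piece, with the slot's remaining nonnegative factor
`R ≤ M` riding along.  Everything is [folklore] arithmetic ∕ monotonicity of the integral; nothing of Bałaban's is
asserted; the residual [dict] (which functionals are slots, that they inject into cubes × kinds, that they are `Readings`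
of NE3's family) is NODE O's, named not discharged.  Spine estimates PROVED 0/9 before and after.  HONEST DEPENDENCY:
continuum YM on T⁴ ⇐ BetaPertH ∧ nine spine estimates (0/9 proved); BetaPertH ⇐ (D1) ∧ (D4) ∧ CAP+tail; G-an2-4 gates
asym, D1 and NE2/3/4.

CONSUMER (trigger c6: «a seat landing a leaf says which road's END consumes it»): road P1's END-I
`shellWeightBound_of_slotAC` — binders `hwA`∕`hwB` (§1), `hrateA`∕`hrateB` + `0 < ϑ < 1` (§2) — and its `_band` twin
through `ShellMeasureBandCount.shellWeightBound_of_levels_band` (§1 `ageCount_of_torusCount`, §2 `summable_geomWidth'`);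
§3 serves the owner's `SlotData` instances (field `piece_le`).  Unit `b2b-balaban-t4-ne7c-p2` gen 23 (journal CLAIMS.log
l.5472, «CLAIM NE7c-S9»). [folklore]
-/

noncomputable section

open Finset MeasureTheory
open scoped ENNReal

namespace Summit.QuantumFields.BalabanUV.T4Continuum.ShellMeasureWindowLiaison

open Literature.MathematicalPhysics.QuantumFieldTheory.Balaban1983to89
open T4IndicatorShell T4ShellMeasure T4ShellMeasureLevels T4ShellCount T4SupCloseLiaison
open ShellMeasureBandCount ShellCountRoad

/-! ## §1 SM-L7: the live window and the slot count from the torus cube count -/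

section Window

variable {σ : Type*} {S : ℕ → Finset σ} {lvl : ℕ → σ → ℕ} {N₁ : ℕ}

/-- **END-I's binder `hwX : LiveWindow S lvl N₁ ν̄` FROM THE TORUS CUBE COUNT.**  (W1) — every slot of comparison `K`
sits at a level `j` with `K − N₁ ≤ j ≤ K` — plus the COUNT «at most `k₀` slots (kinds) per unit cube of the age-`a`
lattice, which on the torus of `M` final cubes per direction and blocking factor `L` has at most `(M·L^a)^4` unit cubes»
give `LiveWindow S lvl N₁ (k₀·M⁴·(L⁴)^{N₁})` (`ShellCountRoad.cubeCount_of_torus` ∘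
`ShellMeasureBandCount.liveWindow_of_cubeCount`).  The count hypothesis is the [dict] reading of B14 (2.17) ∕ B15 (1.3)
(one characteristic function per cube per kind), NOT an estimate. [folklore] -/
theorem liveWindow_of_torusCount (hrec : ∀ K, ∀ s ∈ S K, K ≤ lvl K s + N₁) (htop : ∀ K, ∀ s ∈ S K, lvl K s ≤ K)
    {n : ℕ → ℕ} (hn : ∀ K, ∀ a ≤ N₁, ((S K).filter fun s => K - lvl K s = a).card ≤ n a)
    {k₀ M L : ℝ} (hk₀ : 0 ≤ k₀) (hM : 0 ≤ M) (hL : 1 ≤ L) (hcount : ∀ a ≤ N₁, (n a : ℝ) ≤ k₀ * (M * L ^ a) ^ 4) :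
    LiveWindow S lvl N₁ (k₀ * M ^ 4 * (L ^ 4) ^ N₁) :=
  liveWindow_of_cubeCount hrec htop hn (cubeCount_of_torus hcount) (mul_nonneg hk₀ (pow_nonneg hM 4))
    (one_le_pow₀ (by nlinarith [hL]))

/-- The same count in the `_band` twin's AGE-COUNT shape (real-valued bound `m a = k₀·(M·L^a)^4`), ready for
`ShellMeasureBandCount.shellWeightBound_of_levels_band` ∕ `tsum_wsh_le_band`. [folklore] -/
theorem ageCount_of_torusCount {n : ℕ → ℕ}
    (hn : ∀ K, ∀ a ≤ N₁, ((S K).filter fun s => K - lvl K s = a).card ≤ n a)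
    {k₀ M L : ℝ} (hcount : ∀ a ≤ N₁, (n a : ℝ) ≤ k₀ * (M * L ^ a) ^ 4) :
    ∀ K, ∀ a ≤ N₁, (((S K).filter fun s => K - lvl K s = a).card : ℝ) ≤ k₀ * (M * L ^ a) ^ 4 :=
  fun K a ha => (Nat.cast_le.2 (hn K a ha)).trans (hcount a ha)

/-- … and the band constant it produces: `C₀(m, D̄) ≤ D̄ · k₀M⁴ · Σ_{a ≤ N₁} (L⁴)^a` (window entropy paid once;
`ShellMeasureBandCount.C0_const_le_of_cubeCount`). [folklore] -/
theorem C0_torusCount_le {n : ℕ → ℕ} {k₀ M L Dbar : ℝ} (hcount : ∀ a ≤ N₁, (n a : ℝ) ≤ k₀ * (M * L ^ a) ^ 4)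
    (hDbar : 0 ≤ Dbar) :
    C0 N₁ (fun a => (n a : ℝ)) (fun _ => Dbar) ≤ Dbar * (k₀ * M ^ 4 * ∑ a ∈ range (N₁ + 1), (L ^ 4) ^ a) :=
  C0_const_le_of_cubeCount (cubeCount_of_torus hcount) hDbar

end Window

/-! ## §2 SM-L8: the rate binder in node U1b's shape (NO rate proved — trigger c4) -/

section Rate

variable {C θmin ϑ : ℝ}

/-- **END-I's binder `hrateX : ∀ j, ρ j ≤ c₁·ϑ^j`** for node U1b's width `ρ = geomWidth C θmin ϑ` with `c₁ = C∕θmin`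
(`T4SupCloseLiaison.geomWidth_le_rate`, by `le_rfl`): the shell-measure END's rate field IS the liaison's closed form.
The rate itself (`T4EtaRateMin.LocalRate R C ϑ` for Bałaban's backgrounds) is node U1b's ∕ row NE3's, NOT PRINTED, and
is NOT proved here. [folklore] -/
theorem rate_geomWidth (C θmin ϑ : ℝ) : ∀ j, geomWidth C θmin ϑ j ≤ C / θmin * ϑ ^ j :=
  geomWidth_le_rate C θmin ϑ

/-- the width is nonnegative (END-I's `hρ0`). [folklore] -/
theorem geomWidth_nonneg' (hC : 0 ≤ C) (hθ : 0 ≤ θmin) (hϑ : 0 ≤ ϑ) : ∀ j, 0 ≤ geomWidth C θmin ϑ j :=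
  geomWidth_nonneg hC hθ hϑ

/-- the width is summable for `0 ≤ ϑ < 1` (the `_band` twin's `Summable ρ`), with total `(C∕θmin)(1 − ϑ)⁻¹`.
[folklore] -/
theorem summable_geomWidth' (hϑ0 : 0 ≤ ϑ) (hϑ1 : ϑ < 1) :
    Summable (geomWidth C θmin ϑ) ∧ ∑' j, geomWidth C θmin ϑ j = C / θmin * (1 - ϑ)⁻¹ :=
  ⟨summable_geomWidth hϑ0 hϑ1, tsum_geomWidth hϑ0 hϑ1⟩

/-- READING: under `LocalRate R C ϑ`, the local readings of an admissible datum at consecutive levels `j`, `j + 1`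
differ by at most `C·ϑ^j` — the two runs' tested variables of a level-`j` slot, once they ARE such readings ([dict],
`T4SupCloseLiaison.ReadsLevels`). [folklore] -/
theorem abs_sub_le_of_localRate {ι X : Type*} {R : T4EtaRateMin.Readings ι X} (hloc : T4EtaRateMin.LocalRate R C ϑ)
    {V : ι} (hV : V ∈ R.dom) (x : X) (j : ℕ) : |R.loc (j + 1) V x - R.loc j V x| ≤ C * ϑ ^ j :=
  hloc j V hV x

/-- … hence, relative to any threshold above the floor `θmin > 0`, by at most `ρ_j · θ` with `ρ = geomWidth C θmin ϑ`
(`T4SupCloseLiaison.abs_sub_le_geomWidth_mul`). [folklore] -/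
theorem abs_sub_le_geomWidth_of_localRate {ι X : Type*} {R : T4EtaRateMin.Readings ι X}
    (hloc : T4EtaRateMin.LocalRate R C ϑ) {V : ι} (hV : V ∈ R.dom) (x : X) (j : ℕ) (hmin : 0 < θmin) {θ : ℝ}
    (hθ : θmin ≤ θ) : |R.loc j V x - R.loc (j + 1) V x| ≤ geomWidth C θmin ϑ j * θ :=
  abs_sub_le_geomWidth_mul (hloc j V hV x) hmin hθ

end Rate

/-! ## §3 The one-slot closeness push: mismatch factor ≤ indicator of the `SlotAntiConcentration` event -/

section Push

/-- the relative shell below `θ` IS the indicator of the `SlotAntiConcentration` event `{θ(1 − ρ) ≤ u < θ}`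
(`T4IndicatorShell.shellBelow` with `Δ = ρθ`, rewritten). [folklore] -/
theorem shellBelow_rel_eq_indicator (u θ ρ : ℝ) :
    shellBelow u θ (ρ * θ) = Set.indicator {v : ℝ | θ * (1 - ρ) ≤ v ∧ v < θ} 1 u := by
  have e : θ - ρ * θ = θ * (1 - ρ) := by ring
  unfold shellBelow
  rw [e]
  by_cases h : θ * (1 - ρ) ≤ u ∧ u < θ
  · rw [if_pos h, Set.indicator_of_mem (show u ∈ {v : ℝ | θ * (1 - ρ) ≤ v ∧ v < θ} from h)]; rfl
  · rw [if_neg h, Set.indicator_of_notMem (show u ∉ {v : ℝ | θ * (1 - ρ) ≤ v ∧ v < θ} from h)]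

/-- **POINTWISE PUSH.**  If the two runs' tested variables at a point are `ρθ`-close, the design-(i) mismatch factor
`χ_θ(u^A)(1 − χ_θ(u^B))` is at most the indicator of the `SlotAntiConcentration` event `{θ(1 − ρ) ≤ u^A < θ}`
(`T4IndicatorShell.smallInd_mul_one_sub_le`). [folklore] -/
theorem mismatch_le_indicator {uA uB θ ρ : ℝ} (h : |uA - uB| ≤ ρ * θ) :
    smallInd uA θ * (1 - smallInd uB θ) ≤ Set.indicator {v : ℝ | θ * (1 - ρ) ≤ v ∧ v < θ} 1 uA := by
  rw [← shellBelow_rel_eq_indicator]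
  exact smallInd_mul_one_sub_le h

/-- … the same from a `LocalRate` reading at the slot's level and the threshold floor, with `ρ = geomWidth C θmin ϑ`:
the closeness input of node U1b lands EXACTLY on road P1's event. [folklore] -/
theorem mismatch_le_indicator_of_localRate {ι X : Type*} {R : T4EtaRateMin.Readings ι X} {C θmin ϑ : ℝ}
    (hloc : T4EtaRateMin.LocalRate R C ϑ) {V : ι} (hV : V ∈ R.dom) (x : X) (j : ℕ) (hmin : 0 < θmin) {θ : ℝ}
    (hθ : θmin ≤ θ) :
    smallInd (R.loc j V x) θ * (1 - smallInd (R.loc (j + 1) V x) θ) ≤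
      Set.indicator {v : ℝ | θ * (1 - geomWidth C θmin ϑ j) ≤ v ∧ v < θ} 1 (R.loc j V x) :=
  mismatch_le_indicator (abs_sub_le_geomWidth_of_localRate hloc hV x j hmin hθ)

/-- the mismatch factor is nonnegative … [folklore] -/
theorem mismatch_nonneg (uA uB θ : ℝ) : 0 ≤ smallInd uA θ * (1 - smallInd uB θ) :=
  mul_nonneg (smallInd_nonneg _ _) (sub_nonneg.2 (smallInd_le_one _ _))

/-- … and at most `1`. [folklore] -/
theorem mismatch_le_one (uA uB θ : ℝ) : smallInd uA θ * (1 - smallInd uB θ) ≤ 1 :=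
  mul_le_one₀ (smallInd_le_one _ _) (sub_nonneg.2 (smallInd_le_one _ _)) (sub_le_self _ (smallInd_nonneg _ _))

variable {Ω : Type*} [MeasurableSpace Ω]

/-- **INTEGRATED PUSH (one mismatch piece of one slot).**  On the slot's realized space with positive measure `μ` (the
slot's OWN indicator summed out — reading (R)), if the two runs' tested variables are `ρθ`-close `μ`-a.e. and the
remaining nonnegative factor `Rm` of the piece is at most `M`, then
`∫⁻ χ_θ(u^A)(1 − χ_θ(u^B))·Rm dμ ≤ M · μ {θ(1 − ρ) ≤ u^A < θ}` — the shape of a `SlotData.piece_le` field, the event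
being LITERALLY `T4ShellMeasure.SlotAntiConcentration`'s.  No law of `u^A` is used. [folklore] -/
theorem lintegral_mismatch_le (μ : Measure Ω) {uA uB : Ω → ℝ} (huA : Measurable uA) {θ ρ : ℝ} {Rm : Ω → ℝ≥0∞}
    {M : ℝ≥0∞} (hclose : ∀ᵐ ω ∂μ, |uA ω - uB ω| ≤ ρ * θ) (hRm : ∀ᵐ ω ∂μ, Rm ω ≤ M) :
    ∫⁻ ω, ENNReal.ofReal (smallInd (uA ω) θ * (1 - smallInd (uB ω) θ)) * Rm ω ∂μ ≤
      M * μ {ω | θ * (1 - ρ) ≤ uA ω ∧ uA ω < θ} := by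
  have hE : MeasurableSet {ω | θ * (1 - ρ) ≤ uA ω ∧ uA ω < θ} :=
    (huA measurableSet_Ici).inter (huA measurableSet_Iio)
  calc ∫⁻ ω, ENNReal.ofReal (smallInd (uA ω) θ * (1 - smallInd (uB ω) θ)) * Rm ω ∂μ
      ≤ ∫⁻ ω, Set.indicator {ω | θ * (1 - ρ) ≤ uA ω ∧ uA ω < θ} (fun _ => M) ω ∂μ := by
        refine lintegral_mono_ae ?_
        filter_upwards [hclose, hRm] with ω hω hR
        have hpt := mismatch_le_indicator hω
        by_cases hmem : θ * (1 - ρ) ≤ uA ω ∧ uA ω < θ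
        · rw [Set.indicator_of_mem (show ω ∈ {ω | θ * (1 - ρ) ≤ uA ω ∧ uA ω < θ} from hmem)]
          calc ENNReal.ofReal (smallInd (uA ω) θ * (1 - smallInd (uB ω) θ)) * Rm ω ≤ 1 * M := by
                gcongr
                rw [← ENNReal.ofReal_one]
                exact ENNReal.ofReal_le_ofReal (mismatch_le_one _ _ _)
            _ = M := one_mul M
        · have h0 : smallInd (uA ω) θ * (1 - smallInd (uB ω) θ) ≤ 0 := by
            have := hpt
            rwa [Set.indicator_of_notMem (show uA ω ∉ {v : ℝ | θ * (1 - ρ) ≤ v ∧ v < θ} from hmem)] at this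
          rw [ENNReal.ofReal_of_nonpos h0, zero_mul]
          exact bot_le
    _ = M * μ {ω | θ * (1 - ρ) ≤ uA ω ∧ uA ω < θ} := by
        rw [lintegral_indicator_const hE]

/-- **THE PUSH IN `SlotAntiConcentration` CURRENCY.**  If moreover the slot obeys (M1) `SlotAntiConcentration μ u^A θ ρ D`
(road P1's binder — NOT proved here), the mismatch piece weighs at most `M · D·ρ · μ(univ)`: the per-slot relative
bound `c = D_j ρ_j` of the level ledger, times the [dict] constant. [folklore] -/
theorem lintegral_mismatch_le_of_slotAC (μ : Measure Ω) {uA uB : Ω → ℝ} (huA : Measurable uA) {θ ρ D : ℝ}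
    {Rm : Ω → ℝ≥0∞} {M : ℝ≥0∞} (hclose : ∀ᵐ ω ∂μ, |uA ω - uB ω| ≤ ρ * θ) (hRm : ∀ᵐ ω ∂μ, Rm ω ≤ M)
    (hac : SlotAntiConcentration μ uA θ ρ D) :
    ∫⁻ ω, ENNReal.ofReal (smallInd (uA ω) θ * (1 - smallInd (uB ω) θ)) * Rm ω ∂μ ≤
      M * (ENNReal.ofReal (D * ρ) * μ Set.univ) :=
  (lintegral_mismatch_le μ huA hclose hRm).trans (mul_le_mul' le_rfl hac)

/-- **REAL-VALUED FORM** (the literal currency of a `SlotData.piece_le` field, `M · (μ E).toReal`): for a finite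
measure, a real remaining factor `0 ≤ Rm ≤ M` a.e. and `ρθ`-close tested variables,
`∫ χ_θ(u^A)(1 − χ_θ(u^B))·Rm dμ ≤ M · (μ {θ(1 − ρ) ≤ u^A < θ}).toReal` (no integrability hypothesis on the left: a
non-integrable left side integrates to `0`). [folklore] -/
theorem integral_mismatch_le (μ : Measure Ω) [IsFiniteMeasure μ] {uA uB : Ω → ℝ} (huA : Measurable uA) {θ ρ : ℝ}
    {Rm : Ω → ℝ} {M : ℝ} (hclose : ∀ᵐ ω ∂μ, |uA ω - uB ω| ≤ ρ * θ) (hRm0 : ∀ᵐ ω ∂μ, 0 ≤ Rm ω)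
    (hRm : ∀ᵐ ω ∂μ, Rm ω ≤ M) :
    ∫ ω, smallInd (uA ω) θ * (1 - smallInd (uB ω) θ) * Rm ω ∂μ ≤
      M * (μ {ω | θ * (1 - ρ) ≤ uA ω ∧ uA ω < θ}).toReal := by
  have hE : MeasurableSet {ω | θ * (1 - ρ) ≤ uA ω ∧ uA ω < θ} :=
    (huA measurableSet_Ici).inter (huA measurableSet_Iio)
  have hg : Integrable ({ω | θ * (1 - ρ) ≤ uA ω ∧ uA ω < θ}.indicator fun _ => M) μ :=
    (integrable_const M).indicator hE
  calc ∫ ω, smallInd (uA ω) θ * (1 - smallInd (uB ω) θ) * Rm ω ∂μ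
      ≤ ∫ ω, {ω | θ * (1 - ρ) ≤ uA ω ∧ uA ω < θ}.indicator (fun _ => M) ω ∂μ := by
        refine integral_mono_of_nonneg ?_ hg ?_
        · filter_upwards [hRm0] with ω hR
          exact mul_nonneg (mismatch_nonneg _ _ _) hR
        · filter_upwards [hclose, hRm0, hRm] with ω hω hR0 hR
          have hpt := mismatch_le_indicator hω
          by_cases hmem : θ * (1 - ρ) ≤ uA ω ∧ uA ω < θ
          · rw [Set.indicator_of_mem (show ω ∈ {ω | θ * (1 - ρ) ≤ uA ω ∧ uA ω < θ} from hmem)]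
            calc smallInd (uA ω) θ * (1 - smallInd (uB ω) θ) * Rm ω ≤ 1 * M :=
                  mul_le_mul (mismatch_le_one _ _ _) hR hR0 zero_le_one
              _ = M := one_mul M
          · rw [Set.indicator_of_notMem (show ω ∉ {ω | θ * (1 - ρ) ≤ uA ω ∧ uA ω < θ} from hmem)]
            have h0 : smallInd (uA ω) θ * (1 - smallInd (uB ω) θ) ≤ 0 := by
              have := hpt
              rwa [Set.indicator_of_notMem (show uA ω ∉ {v : ℝ | θ * (1 - ρ) ≤ v ∧ v < θ} from hmem)] at this
            have h0' : smallInd (uA ω) θ * (1 - smallInd (uB ω) θ) = 0 := le_antisymm h0 (mismatch_nonneg _ _ _)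
            rw [h0', zero_mul]
    _ = M * (μ {ω | θ * (1 - ρ) ≤ uA ω ∧ uA ω < θ}).toReal := by
        rw [integral_indicator_const M hE, smul_eq_mul, mul_comm]
        rfl

end Push

/-! ## §4 Sanity: the binders of END-I produced here are jointly inhabited (kernel `example`s) -/

section Sanity

/-- SANITY (§1): no slots ⇒ the torus count holds with `n ≡ 0` and gives `LiveWindow` with `ν̄ = k₀M⁴(L⁴)^{N₁}` for any
`k₀, M ≥ 0`, `L ≥ 1`. [folklore] -/
example (N₁ : ℕ) : LiveWindow (fun _ => (∅ : Finset Unit)) (fun _ _ => 0) N₁ (1 * 2 ^ 4 * (2 ^ 4) ^ N₁) :=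
  liveWindow_of_torusCount (S := fun _ => (∅ : Finset Unit)) (lvl := fun _ _ => 0) (n := fun _ => 0)
    (fun _ _ h => by simp at h) (fun _ _ h => by simp at h) (fun _ _ _ => by simp) zero_le_one (by norm_num)
    (by norm_num) (fun _ _ => by simp only [Nat.cast_zero]; positivity)

/-- SANITY (§2): the rate binder for `C = θmin = 1`, `ϑ = 1/2` reads `(1/2)^j ≤ 1·(1/2)^j`, and the width sums to `2`.
[folklore] -/
example : (∀ j, geomWidth 1 1 (1 / 2 : ℝ) j ≤ 1 / 1 * (1 / 2) ^ j) ∧ ∑' j, geomWidth 1 1 (1 / 2 : ℝ) j = 2 := by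
  refine ⟨rate_geomWidth 1 1 (1 / 2), ?_⟩
  rw [(summable_geomWidth' (C := 1) (θmin := 1) (by norm_num : (0 : ℝ) ≤ 1 / 2) (by norm_num)).2]
  norm_num

/-- SANITY (§3): on the one-point space with `u^A = θ(1 − ρ/2)`, `u^B = θ(1 + ρ/2)` (`θ, ρ > 0`) the two runs are
`ρθ`-close, the point lies in the event, and the integrated push reads `M·1 ≤ M·1`-type: the bound is attained (the
mismatch factor is `1` there) — the push loses nothing on a shell atom. [folklore] -/
example {θ ρ : ℝ} (hθ : 0 < θ) (hρ : 0 < ρ) :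
    |θ * (1 - ρ / 2) - θ * (1 + ρ / 2)| ≤ ρ * θ ∧ (θ * (1 - ρ) ≤ θ * (1 - ρ / 2) ∧ θ * (1 - ρ / 2) < θ) := by
  refine ⟨?_, by nlinarith, by nlinarith⟩
  rw [show θ * (1 - ρ / 2) - θ * (1 + ρ / 2) = -(ρ * θ) by ring, abs_neg, abs_of_pos (mul_pos hρ hθ)]

end Sanity

end Summit.QuantumFields.BalabanUV.T4Continuum.ShellMeasureWindowLiaison

end
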